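import Summits.BirchSwinnertonDyer.BirchSwinnertonDyer.Theorems.PrintCf2RamifiedOffTYZMoverCoordinates
import HarnessLib

/-!
# Route `PrintCf2`, crux stmt-BirchSwinnertonDyer-20509 `RamifiedOffTYZOfFacts` — SIGN CHARACTERS ON `Gal(ℍ′_n/ℚ)`: a square root `w` of a rational
# `ξ ∉ {1, −1, n, −n}·ℚ^{×2}` is NEGATED by some automorphism fixing `i` and `√−n`
# (cell `bsd-print-cf2`, LEAD of 20509 g11, line `offtyz-v7`, lineage cycle 12; Galois bookkeeping for `…HalfMover`; fact-free, Theses-free, no `def`)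

HONEST FRAMING (crux 20509, DECIDING, OPEN AS A CLASS): pure Galois theory on the displayed number field `D.H = ℍ′_n` (Galois over `ℚ`, containing
`i` and `√−n`; `D : GenusPointData n`) with Mathlib's `IsGalois.mem_bot_iff_fixed`; nothing about `E_n` is used or asserted.  Consumer: the sequel
`…HalfMover` (existence of a half-mover when `x(R) ∉ {±1, ±n}·ℚ^{×2}`, i.e. `ρ(n) = 1`).

* §1 `exists_pow_pow_of_trivial_on_ker` (abstract): three `±1`-valued multiplicative functions `a, b, c` on a group with `c = 1` wherever `a = b = 1`
  satisfy `c = a^α·b^β` for some `α, β` (four-coset casework: `c` is constant on `(a, b)`-classes, and the classes multiply).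
* §2 `exists_algEquiv_apply_eq_neg_of_sq_eq`: if `w ∈ ℍ′_n`, `w² = ξ ∈ ℚ`, `ξ ∉ {1, −1, n, −n}·ℚ^{×2}`, then some `g ∈ Aut_ℚ(ℍ′_n)` has `g(i) = i`,
  `g(√−n) = √−n`, `g(w) = −w`.  (Else §1 applied to the sign characters of `i`, `√−n`, `w` makes `w·i^α(√−n)^β` fixed by every `g`, hence rational
  `= q`, and `ξ = q²·(i²)^{−α}((√−n)²)^{−β} ∈ {1, −1, n, −n}·ℚ^{×2}`.)

Beyond-print theorem: NO (Galois bookkeeping).  BSD is not proved by any of this; no class is closed by this file.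

References: [cite: Cox2013, §6.A Thm. 6.1] (genus characters as quadratic characters of the Galois group); [cite: TianYuanZhang2017, §3.1 (p0011 L60–L64:
`L_n(i) = ℚ(i, √d : d ∣ n) ⊂ ℍ′_n`)]; tree: `…MoverCoordinates` (`apply_eq_or_of_sq_eq`, `eq_zero_of_eq_neg'`), Mathlib `FieldTheory.Galois.Basic`.
-/

noncomputable section

open scoped Classical

open Literature.NumberTheory.EllipticCurves Literature.NumberTheory.EllipticCurves.TianYuanZhang2017
  Summit.BirchSwinnertonDyer.PrintCf2.MoverAssembly

set_option autoImplicit false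

namespace Summit.BirchSwinnertonDyer.PrintCf2.SignCharacters

/-! ## §1 Three `±1`-valued characters: `c` trivial on `ker a ∩ ker b` is a product of powers of `a` and `b` -/

section Abstract

variable {G : Type*} [Group G] {F : Type*} [Field F]

/-- `u·u = 1` for `u = ±1`. [folklore] -/
private theorem pm_mul_self {u : F} (hu : u = 1 ∨ u = -1) : u * u = 1 := by
  rcases hu with rfl | rfl <;> norm_num

/-- `u·v = 1` with `v = ±1` forces `u = v`. [folklore] -/
private theorem eq_of_mul_eq_one {u v : F} (hv : v = 1 ∨ v = -1) (h : u * v = 1) : u = v := by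
  calc u = u * (v * v) := by rw [pm_mul_self hv, mul_one]
    _ = (u * v) * v := by ring
    _ = v := by rw [h, one_mul]

/-- **Three `±1`-valued multiplicative functions with `c = 1` on `{a = 1} ∩ {b = 1}`**: then `c = a^α·b^β` for some `α, β ∈ {0, 1}`.
(`c` is constant on each of the four `(a,b)`-classes, and the classes multiply.) [folklore] -/
theorem exists_pow_pow_of_trivial_on_ker [CharZero F] (a b c : G → F)
    (ha : ∀ g, a g = 1 ∨ a g = -1) (hb : ∀ g, b g = 1 ∨ b g = -1) (hc : ∀ g, c g = 1 ∨ c g = -1)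
    (hma : ∀ g h, a (g * h) = a g * a h) (hmb : ∀ g h, b (g * h) = b g * b h) (hmc : ∀ g h, c (g * h) = c g * c h)
    (hker : ∀ g, a g = 1 → b g = 1 → c g = 1) :
    ∃ α β : ℕ, ∀ g, c g = a g ^ α * b g ^ β := by
  -- `c` is constant on `(a,b)`-classes
  have hconst : ∀ g h, a g = a h → b g = b h → c g = c h := by
    intro g h hag hbg
    have h1 : a (g * h) = 1 := by rw [hma, hag, pm_mul_self (ha h)]
    have h2 : b (g * h) = 1 := by rw [hmb, hbg, pm_mul_self (hb h)]
    have h3 : c g * c h = 1 := by rw [← hmc]; exact hker _ h1 h2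
    exact eq_of_mul_eq_one (hc h) h3
  have hm1 : (-1 : F) ≠ 1 := by norm_num
  by_cases hA : ∃ gA, a gA = -1 ∧ b gA = 1
  · obtain ⟨gA, haA, hbA⟩ := hA
    by_cases hB : ∃ gB, a gB = 1 ∧ b gB = -1
    · obtain ⟨gB, haB, hbB⟩ := hB
      -- exponents read off `c gA`, `c gB`
      refine ⟨if c gA = 1 then 0 else 1, if c gB = 1 then 0 else 1, fun g => ?_⟩
      rcases ha g with hag | hag <;> rcases hb g with hbg | hbg
      · rw [hker g hag hbg, hag, hbg, one_pow, one_pow, mul_one]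
      · -- class of `gB`
        rw [hconst g gB (hag.trans haB.symm) (hbg.trans hbB.symm), hag, hbg, one_pow, one_mul]
        rcases hc gB with h | h
        · rw [if_pos h, h, pow_zero]
        · rw [if_neg (by rw [h]; exact hm1), h, pow_one]
      · -- class of `gA`
        rw [hconst g gA (hag.trans haA.symm) (hbg.trans hbA.symm), hag, hbg, one_pow, mul_one]
        rcases hc gA with h | h
        · rw [if_pos h, h, pow_zero]
        · rw [if_neg (by rw [h]; exact hm1), h, pow_one]
      · -- class of `gA * gB`
        have haAB : a (gA * gB) = -1 := by rw [hma, haA, haB]; norm_num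
        have hbAB : b (gA * gB) = -1 := by rw [hmb, hbA, hbB]; norm_num
        rw [hconst g (gA * gB) (hag.trans haAB.symm) (hbg.trans hbAB.symm), hmc, hag, hbg]
        rcases hc gA with h1 | h1 <;> rcases hc gB with h2 | h2
        · rw [if_pos h1, if_pos h2, h1, h2]; norm_num
        · rw [if_pos h1, if_neg (by rw [h2]; exact hm1), h1, h2]; norm_num
        · rw [if_neg (by rw [h1]; exact hm1), if_pos h2, h1, h2]; norm_num
        · rw [if_neg (by rw [h1]; exact hm1), if_neg (by rw [h2]; exact hm1), h1, h2]; norm_num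
    · -- no `(1,−1)` element; then no `(−1,−1)` element either (multiply by `gA`)
      have hC : ¬ ∃ gC, a gC = -1 ∧ b gC = -1 := by
        rintro ⟨gC, haC, hbC⟩
        exact hB ⟨gC * gA, by rw [hma, haC, haA]; norm_num, by rw [hmb, hbC, hbA]; norm_num⟩
      refine ⟨if c gA = 1 then 0 else 1, 0, fun g => ?_⟩
      rcases ha g with hag | hag <;> rcases hb g with hbg | hbg
      · rw [hker g hag hbg, hag, one_pow, pow_zero, mul_one]
      · exact absurd ⟨g, hag, hbg⟩ hB
      · rw [hconst g gA (hag.trans haA.symm) (hbg.trans hbA.symm), hag, pow_zero, mul_one]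
        rcases hc gA with h | h
        · rw [if_pos h, h, pow_zero]
        · rw [if_neg (by rw [h]; exact hm1), h, pow_one]
      · exact absurd ⟨g, hag, hbg⟩ hC
  · by_cases hB : ∃ gB, a gB = 1 ∧ b gB = -1
    · obtain ⟨gB, haB, hbB⟩ := hB
      have hC : ¬ ∃ gC, a gC = -1 ∧ b gC = -1 := by
        rintro ⟨gC, haC, hbC⟩
        exact hA ⟨gC * gB, by rw [hma, haC, haB]; norm_num, by rw [hmb, hbC, hbB]; norm_num⟩
      refine ⟨0, if c gB = 1 then 0 else 1, fun g => ?_⟩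
      rcases ha g with hag | hag <;> rcases hb g with hbg | hbg
      · rw [hker g hag hbg, hbg, one_pow, pow_zero, one_mul]
      · rw [hconst g gB (hag.trans haB.symm) (hbg.trans hbB.symm), hbg, pow_zero, one_mul]
        rcases hc gB with h | h
        · rw [if_pos h, h, pow_zero]
        · rw [if_neg (by rw [h]; exact hm1), h, pow_one]
      · exact absurd ⟨g, hag, hbg⟩ hA
      · exact absurd ⟨g, hag, hbg⟩ hC
    · by_cases hC : ∃ gC, a gC = -1 ∧ b gC = -1
      · obtain ⟨gC, haC, hbC⟩ := hC
        refine ⟨if c gC = 1 then 0 else 1, 0, fun g => ?_⟩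
        rcases ha g with hag | hag <;> rcases hb g with hbg | hbg
        · rw [hker g hag hbg, hag, one_pow, pow_zero, mul_one]
        · exact absurd ⟨g, hag, hbg⟩ hB
        · exact absurd ⟨g, hag, hbg⟩ hA
        · rw [hconst g gC (hag.trans haC.symm) (hbg.trans hbC.symm), hag, pow_zero, mul_one]
          rcases hc gC with h | h
          · rw [if_pos h, h, pow_zero]
          · rw [if_neg (by rw [h]; exact hm1), h, pow_one]
      · refine ⟨0, 0, fun g => ?_⟩
        rcases ha g with hag | hag <;> rcases hb g with hbg | hbg
        · rw [hker g hag hbg, pow_zero, pow_zero, mul_one]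
        · exact absurd ⟨g, hag, hbg⟩ hB
        · exact absurd ⟨g, hag, hbg⟩ hA
        · exact absurd ⟨g, hag, hbg⟩ hC

end Abstract

/-! ## §2 Galois: a square root of a rational number outside `{±1, ±n}·ℚ^{×2}` is negated by some `g` fixing `i` and `√−n` -/

variable {n : ℕ}

/-- The sign of `g` on a square root `r` of a rational number: `g r = ε·r` with `ε = ±1`, written as the element `ε ∈ ℍ′_n`. [folklore] -/
private theorem exists_sign (D : GenusPointData n) (g : D.H ≃ₐ[ℚ] D.H) {r : D.H} {ξ : ℚ} (hr : r ^ 2 = algebraMap ℚ D.H ξ)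
    (hr0 : r ≠ 0) : ∃ ε : D.H, (ε = 1 ∨ ε = -1) ∧ g r = ε * r ∧ ∀ ε' : D.H, g r = ε' * r → ε' = ε := by
  rcases apply_eq_or_of_sq_eq (g : D.H →+* D.H) hr (by exact g.commutes ξ) with h | h
  · refine ⟨1, Or.inl rfl, by rw [one_mul]; exact h, fun ε' h' => ?_⟩
    exact mul_right_cancel₀ hr0 (by rw [← h', one_mul]; exact h)
  · refine ⟨-1, Or.inr rfl, by rw [neg_one_mul]; exact h, fun ε' h' => ?_⟩
    exact mul_right_cancel₀ hr0 (by rw [← h', neg_one_mul]; exact h)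

/-- **A square root `w` of `ξ ∈ ℚ` with `ξ ∉ {1, −1, n, −n}·ℚ^{×2}` is negated by some `g ∈ Aut_ℚ(ℍ′_n)` fixing `i` and `√−n`.**
(Otherwise §1 gives `g w = (g i/i)^α (g√−n/√−n)^β · w` for all `g`, so `w·(i^α (√−n)^β)` is Galois-fixed, i.e. rational, and
`ξ = q²·(i^α(√−n)^β)^{−2} ∈ {1, −1, −1/n, 1/n}·q²`.) [folklore] -/
theorem exists_algEquiv_apply_eq_neg_of_sq_eq (D : GenusPointData n) (hn : n ∈ n.divisors) {w : D.H} {ξ : ℚ}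
    (hw : w ^ 2 = algebraMap ℚ D.H ξ)
    (hξ : ¬ ∃ q : ℚ, ξ = q ^ 2 ∨ ξ = -q ^ 2 ∨ ξ = n * q ^ 2 ∨ ξ = -(n * q ^ 2)) :
    ∃ g : D.H ≃ₐ[ℚ] D.H, g D.im = D.im ∧ g (D.sqrtNeg n) = D.sqrtNeg n ∧ g w = -w := by
  have hξ0 : ξ ≠ 0 := by rintro rfl; exact hξ ⟨0, Or.inl (by ring)⟩
  have hw0 : w ≠ 0 := by
    intro h0; rw [h0, zero_pow two_ne_zero, eq_comm, map_eq_zero] at hw; exact hξ0 hw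
  have hi0 : D.im ≠ 0 := D.im_ne_zero
  have hs0 : D.sqrtNeg n ≠ 0 := D.sqrtNeg_ne_zero hn
  have hi2 : D.im ^ 2 = algebraMap ℚ D.H (-1) := by rw [D.im_sq, map_neg, map_one]
  have hs2 : D.sqrtNeg n ^ 2 = algebraMap ℚ D.H (-(n : ℚ)) := by rw [D.sqrtNeg_sq n hn, map_neg, map_natCast]
  by_contra hne
  push Not at hne
  -- the three sign functions
  choose a ha hga hau using fun g : D.H ≃ₐ[ℚ] D.H => exists_sign D g hi2 hi0
  choose b hb hgb hbu using fun g : D.H ≃ₐ[ℚ] D.H => exists_sign D g hs2 hs0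
  choose c hc hgc hcu using fun g : D.H ≃ₐ[ℚ] D.H => exists_sign D g hw hw0
  have hfixpm : ∀ (g : D.H ≃ₐ[ℚ] D.H) {ε : D.H}, (ε = 1 ∨ ε = -1) → g ε = ε := by
    intro g ε hε; rcases hε with rfl | rfl
    · exact map_one g
    · rw [map_neg, map_one]
  have hmul : ∀ {r : D.H} (e : (D.H ≃ₐ[ℚ] D.H) → D.H), (∀ g, e g = 1 ∨ e g = -1) → (∀ g, g r = e g * r) →
      (∀ g (ε' : D.H), g r = ε' * r → ε' = e g) → ∀ g h, e (g * h) = e g * e h := by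
    intro r e he hge heu g h
    symm
    apply heu
    rw [AlgEquiv.mul_apply, hge h, map_mul, hfixpm g (he h), hge g]; ring
  have hma := hmul a ha hga hau
  have hmb := hmul b hb hgb hbu
  have hmc := hmul c hc hgc hcu
  have hker : ∀ g, a g = 1 → b g = 1 → c g = 1 := by
    intro g h1 h2
    have hgi : g D.im = D.im := by rw [hga, h1, one_mul]
    have hgs : g (D.sqrtNeg n) = D.sqrtNeg n := by rw [hgb, h2, one_mul]
    rcases hc g with h | h
    · exact h
    · exact absurd (by rw [hgc, h, neg_one_mul]) (hne g hgi hgs)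
  obtain ⟨α, β, hαβ⟩ := exists_pow_pow_of_trivial_on_ker a b c ha hb hc hma hmb hmc hker
  -- `w · i^α · (√−n)^β` is fixed by every `g`
  set e : D.H := D.im ^ α * D.sqrtNeg n ^ β with he
  have he0 : e ≠ 0 := mul_ne_zero (pow_ne_zero _ hi0) (pow_ne_zero _ hs0)
  have hge : ∀ g : D.H ≃ₐ[ℚ] D.H, g e = (a g ^ α * b g ^ β) * e := by
    intro g
    rw [he, map_mul, map_pow, map_pow, hga, hgb, mul_pow, mul_pow]; ring
  have hfix : ∀ g : D.H ≃ₐ[ℚ] D.H, g (w * e) = w * e := by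
    intro g
    rw [map_mul, hgc, hge, hαβ g]
    have hsq : (a g ^ α * b g ^ β) * (a g ^ α * b g ^ β) = 1 := by
      have h1 : a g * a g = 1 := pm_mul_self (ha g)
      have h2 : b g * b g = 1 := pm_mul_self (hb g)
      calc (a g ^ α * b g ^ β) * (a g ^ α * b g ^ β) = (a g * a g) ^ α * (b g * b g) ^ β := by ring
        _ = 1 := by rw [h1, h2, one_pow, one_pow, mul_one]
    linear_combination (w * e) * hsq
  obtain ⟨q, hq⟩ := IntermediateField.mem_bot.mp ((IsGalois.mem_bot_iff_fixed (w * e)).mpr hfix)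
  -- `w = q / e`, `ξ = q² / e²`, `e² ∈ {1, −1, −n, n}` up to the parity of `α, β`
  have hwq : w = algebraMap ℚ D.H q / e := by rw [eq_div_iff he0, hq]
  have hi_even : ∀ m : ℕ, (D.im ^ 2) ^ m = 1 ∨ (D.im ^ 2) ^ m = -1 := by
    intro m; rw [D.im_sq]; rcases Nat.even_or_odd m with hm | hm
    · left; exact hm.neg_one_pow
    · right; exact hm.neg_one_pow
  -- compute `e ^ 2 = (i²)^α (√−n²)^β`
  have he2 : e ^ 2 = (D.im ^ 2) ^ α * (D.sqrtNeg n ^ 2) ^ β := by rw [he]; ring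
  have hξe : algebraMap ℚ D.H ξ * e ^ 2 = algebraMap ℚ D.H (q ^ 2) := by
    rw [← hw, hwq, div_pow, map_pow, div_mul_cancel₀ _ (pow_ne_zero 2 he0)]
  apply hξ
  have hinj : Function.Injective (algebraMap ℚ D.H) := (algebraMap ℚ D.H).injective
  have hn0 : (n : ℚ) ≠ 0 := by exact_mod_cast (Nat.pos_of_mem_divisors hn).ne'
  -- the rational identity `σ·ξ·S = q²` whenever `(i²)^α = σ` and `(√−n²)^β = S`
  have hcase : ∀ σ S : ℚ, (D.im ^ 2) ^ α = algebraMap ℚ D.H σ → (D.sqrtNeg n ^ 2) ^ β = algebraMap ℚ D.H S →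
      σ * (ξ * S) = q ^ 2 := by
    intro σ S hσ hS
    apply hinj
    rw [← hξe, he2, hσ, hS, map_mul, map_mul]; ring
  have hia : (D.im ^ 2) ^ α = algebraMap ℚ D.H 1 ∨ (D.im ^ 2) ^ α = algebraMap ℚ D.H (-1) := by
    rw [map_one, map_neg, map_one]; exact hi_even α
  rcases Nat.even_or_odd β with hβ | hβ
  · obtain ⟨j, hj⟩ := hβ
    have hnj : ((n : ℚ) ^ j) ≠ 0 := pow_ne_zero _ hn0
    have hsb : (D.sqrtNeg n ^ 2) ^ β = algebraMap ℚ D.H (((n : ℚ) ^ j) ^ 2) := by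
      rw [D.sqrtNeg_sq n hn, hj, ← two_mul, pow_mul, neg_sq]
      simp only [map_pow, map_natCast]
      ring
    rcases hia with hσ | hσ
    · have h := hcase _ _ hσ hsb
      exact ⟨q / (n : ℚ) ^ j, Or.inl (by field_simp; linear_combination h)⟩
    · have h := hcase _ _ hσ hsb
      exact ⟨q / (n : ℚ) ^ j, Or.inr (Or.inl (by field_simp; linear_combination -h))⟩
  · obtain ⟨j, hj⟩ := hβ
    have hnj : ((n : ℚ) * (n : ℚ) ^ j) ≠ 0 := mul_ne_zero hn0 (pow_ne_zero _ hn0)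
    have hsb : (D.sqrtNeg n ^ 2) ^ β = algebraMap ℚ D.H (-((n : ℚ) * ((n : ℚ) ^ j) ^ 2)) := by
      rw [D.sqrtNeg_sq n hn, hj, pow_succ, pow_mul, neg_sq]
      simp only [map_neg, map_mul, map_pow, map_natCast]
      ring
    rcases hia with hσ | hσ
    · have h := hcase _ _ hσ hsb
      exact ⟨q / ((n : ℚ) * (n : ℚ) ^ j), Or.inr (Or.inr (Or.inr (by field_simp; linear_combination -h)))⟩
    · have h := hcase _ _ hσ hsb
      exact ⟨q / ((n : ℚ) * (n : ℚ) ^ j), Or.inr (Or.inr (Or.inl (by field_simp; linear_combination h)))⟩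

end Summit.BirchSwinnertonDyer.PrintCf2.SignCharacters

end
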